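import Summits.AtomisticToContinuum.Crystallization.Theorems.PricedLinkCensusTruncatedCensusGapChargeLocality
import Summits.AtomisticToContinuum.Crystallization.Theorems.PricedLinkCensusTruncatedCensusGapSeparatedDenseReduction

/-!
# `TruncatedCensusGap` (stmt-AtomisticToContinuum-14230): the COMPACT-STRATA FORM of the crux

Lead c3 of line `sharp-m-potential-compactness` (crux directory `Cruxes/TruncatedCensusGap/`),
composition of the two landed wave-1 sub-goals:

`truncatedCensusGap_of_separatedDense` — the census gap for UNIFORMLY `1/4`-SEPARATED, `2`-DENSE
(every site has another site within distance `2`) finite injective configurations already implies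
the crux.  Crowded sites are paid by Ruelle superstability in transfer form (p124427), dropped
isolated sites by `e_χ* ≤ −1/24`, and the charge of a kept site is read off its `2(1+η)·nn`-ball
(`isChargeFree_sub_iff`, p127508) so that it changes only next to a dropped site (packing).  The
converse implication is the trivial restriction, so the crux LIVES on the compact strata of rooted
patches of bounded local complexity — the strata on which the line's core `stub_sharpLocalisationSeparated`
and every certificate (SOS / interval arithmetic) are stated.  `[folklore]` bookkeeping; the content
of the crux is untouched.
-/

noncomputable section

namespace Summit.AtomisticToContinuum.Crystallization.Theorems.PricedLinkCensusTruncatedCensusGap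

open Literature.MathematicalPhysics.StatisticalMechanics Literature.Geometry.DiscreteGeometry

/-- **Compact-strata form of the crux.** The census gap restricted to uniformly `1/4`-separated,
`2`-dense finite injective configurations implies `TruncatedCensusGap` (composition of the landed
reduction modulo charge locality, p127709, with the landed charge-locality lemma, p127508). [folklore] -/
theorem truncatedCensusGap_of_separatedDense : (∃ κ : ℝ, 0 < κ ∧ ∀ (N : ℕ) (y : Fin N → EuclideanSpace ℝ (Fin 3)), Function.Injective y → (∀ j k : Fin N, j ≠ k → 1 / 4 ≤ dist (y j) (y k)) → (∀ j : Fin N, ∃ k : Fin N, k ≠ j ∧ dist (y j) (y k) ≤ 2) → (N : ℝ) * (⨅ Q : PeriodicConfiguration 3, Q.energyPerParticle (fun r => min 1 (max 0 (4 - 2 * r)) * lennardJones r)) + κ * (Nat.card {i : Fin N // ¬ IsChargeFree (1 / 100 : ℝ) y i} : ℝ) ≤ interactionEnergy (fun r => min 1 (max 0 (4 - 2 * r)) * lennardJones r) y) → Summit.AtomisticToContinuum.Crystallization.Theses.PricedLinkCensus.TruncatedCensusGap :=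
  truncatedCensusGap_of_separatedDense_of_locality isChargeFree_sub_iff

end Summit.AtomisticToContinuum.Crystallization.Theorems.PricedLinkCensusTruncatedCensusGap

end
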